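import Mathlib
import Summits.NavierStokesRegularity.NavierStokesRegularity.Theses.ClockStretchingLaw
import Summits.NavierStokesRegularity.NavierStokesRegularity.Theorems.ClockStretchingLawClockCeilingUniformClockLaw
import Literature.Analysis.FluidPDE.TypeIAncientMild
import Literature.Analysis.FluidPDE.OseenMildUniqueness
import Literature.Analysis.FluidPDE.CurlFreeLiouville
import Literature.Analysis.FluidPDE.KNSSRemark61
import Literature.Analysis.FluidPDE.TaoEnstrophyLocalisation
import Literature.Analysis.FluidPDE.DirectionDissipation
import HarnessLib

/-!
# Route ClockStretchingLaw, crux `ClockCeiling` (stmt-NavierStokesRegularity-10570) — the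
# class-uniform, all-time gauge VORTICITY FLOOR of singular Type-I models

Portrait clause of the crux's Type-I class `𝒦_C` (jointly smooth on `(−∞,0) × ℝ³`,
divergence-free, KNSS/Oseen-mild, `‖u(t,x)‖ ≤ C/√(−t)`, scale-invariant local energies
`A, E ≤ C`), the vorticity companion of the uniform clock law `stub_uniformClockLaw` (p153352):

**`uniformVorticityFloor`.** For every `C` there is `η = η(C) > 0` such that every element of
`𝒦_C` that is SINGULAR at the space–time origin satisfies, at EVERY time `t < 0`,
`sup_x (−t) ‖ω(t, x)‖ ≥ η` — the gauge vorticity of a Type-I singularity model never dips below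
`η(C)`. (From above, `(−t)‖ω(t,x)‖ ≤ K₀(C)` by KNSS smoothing.) Together with the stretching
clauses `farPastStretchingRung` / `singularStretchingNearZero` this pins the vorticity of any
counterexample to the crux in the scale-invariant window `[η(C), K₀(C)]` at all times, stretched
at gauge rate `≥ 1⁻` both as `t → −∞` and as `t → 0⁻`.

## Proof

* `t = −1`, uniform in the class (`uniformVorticityFloor_at_neg_one`): otherwise singular
  `u_n ∈ 𝒦_C` with `sup_x ‖ω_{u_n}(−1, x)‖ < 1/(n+1)` subconverge on the open slab, values AND
  gradients pointwise (`exists_tendsto_of_typeI_seq_Ioo`, KNSS compactness on growing windows), to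
  an element `W ∈ A_C`, singular at the origin by persistence along sequences of singular class
  elements (`clockLaw_singular_of_limit`), with `curl W(−1) ≡ 0` (continuity of `curlCLM`). A
  bounded curl- and divergence-free slice is constant, `W(−1, ·) ≡ b` (KNSS 2009 Lemma 3.1,
  `eq_of_curl_eq_zero_of_isDivFree_of_bounded`); forward uniqueness of bounded Oseen-mild
  solutions (`oseenMild_bounded_unique`) against the constant solution `b`
  (`heatExtension_const`, `oseenDuhamel_eq_zero_of_const`) gives `W ≡ b` on `(−1, 0) × ℝ³`,
  which is bounded near the origin — contradicting the singularity.
* all `t < 0` by the scaling covariance of the class (`uniformVorticityFloor`): the zoom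
  `u_c = c u(c² ·, c ·)`, `c = √(−t)`, is a singular element of `𝒦_C` (`isTypeIAncientMild_zoom`,
  `limitSingular_energyLedger_zoom`, `clockLaw_singular_zoom`) with
  `curl u_c(−1, y) = (−t) ω(t, c y)` (`curl_smul_stPull`).

## References

* G. Koch, N. Nadirashvili, G. Seregin, V. Šverák, Acta Math. 203 (2009) 83–105, Lemma 3.1,
  Prop. 4.1, Remark 6.1 (arXiv:0709.3599). [KochNadirashviliSereginSverak2009]
* D. Albritton, T. Barker, ARMA 232 (2019), Lemma 2.2 and Prop. 2.3 (persistence of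
  singularities; arXiv:1811.00502). [AlbrittonBarker2019]
-/

noncomputable section

-- the summit and its single sub-problem share the name (CONVENTIONS §1), as in every Theorems file
set_option linter.dupNamespace false

open MeasureTheory Filter Topology Set Metric Function
open scoped NNReal ENNReal

namespace Summit.NavierStokesRegularity.NavierStokesRegularity.Theorems

open Literature.Analysis Literature.Analysis.FluidPDE
open Summit.NavierStokesRegularity.NavierStokesRegularity.Theorems.ClockLaw.Birth

/-- **A Type-I ancient mild field with one CONSTANT slice is constant afterwards**: if `W ∈ A_C`
and `W(s, ·) ≡ b` for some `s`, then `W(t, x) = b` for all `s < t < 0` — on every slab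
`(s, T')`, `T' < 0`, both `W` and the constant field `b` are bounded jointly measurable solutions
of the Oseen integral equation with the same free term `e^{(t−s)Δ}W(s) = b`
(`heatExtension_const`, `oseenDuhamel_eq_zero_of_const`), so they agree a.e.
(`oseenMild_bounded_unique`), hence everywhere by continuity of the slice. [cite: KochNadirashviliSereginSverak2009, §4 p. 8 and Remark 6.1 (arXiv:0709.3599)] -/
theorem eq_const_after_of_slice_const {C : ℝ}
    {W : ℝ → EuclideanSpace ℝ (Fin 3) → EuclideanSpace ℝ (Fin 3)} (hW : IsTypeIAncientMild C W)
    {s : ℝ} {b : EuclideanSpace ℝ (Fin 3)} (hb : ∀ x, W s x = b)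
    {t : ℝ} (hst : s < t) (ht : t < 0) (x : EuclideanSpace ℝ (Fin 3)) : W t x = b := by
  -- the slab `(s, T')`, `T' = t / 2`
  have hT'0 : t / 2 < 0 := by linarith
  have htI : t ∈ Ioo s (t / 2) := ⟨hst, by linarith⟩
  set M : ℝ := max (C / Real.sqrt (-(t / 2))) ‖b‖ with hMdef
  have hM : 0 ≤ M := le_max_of_le_right (norm_nonneg _)
  have huM : ∀ τ ∈ Ioo s (t / 2), ∀ y, ‖W τ y‖ ≤ M := fun τ hτ y =>
    (hW.norm_le_of_mem_Ioo hT'0 hτ y).trans (le_max_left _ _)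
  set V : ℝ → EuclideanSpace ℝ (Fin 3) → EuclideanSpace ℝ (Fin 3) := fun _ _ => b with hVdef
  have hvM : ∀ τ ∈ Ioo s (t / 2), ∀ y : EuclideanSpace ℝ (Fin 3), ‖V τ y‖ ≤ M :=
    fun τ _ y => le_max_right _ _
  have hum := hW.aestronglyMeasurable_uncurry (s := s) hT'0.le
  have hvm : AEStronglyMeasurable (uncurry V)
      ((volume : Measure (ℝ × EuclideanSpace ℝ (Fin 3))).restrict (Ioo s (t / 2) ×ˢ univ)) :=
    aestronglyMeasurable_const
  have hWs : W s = fun _ => b := funext hb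
  -- the two integral equations with the common free term `e^{(τ-s)Δ} W(s) = b`
  have hu : ∀ τ ∈ Ioo s (t / 2), W τ =ᵐ[volume] fun y =>
      UnboundedOperators.heatExtension (W s) (τ - s) y - oseenDuhamel 1 s W W τ y :=
    fun τ hτ => Eventually.of_forall fun y => hW.mild_eq_heatExtension hτ.1 (hτ.2.trans hT'0) y
  have hv : ∀ τ ∈ Ioo s (t / 2), V τ =ᵐ[volume] fun y =>
      UnboundedOperators.heatExtension (W s) (τ - s) y - oseenDuhamel 1 s V V τ y := by
    intro τ hτ
    refine Eventually.of_forall fun y => ?_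
    have hD : oseenDuhamel 1 s V V τ y = 0 :=
      oseenDuhamel_eq_zero_of_const (b := fun _ => b) (c := fun _ => b)
        (fun _ _ _ => rfl) (fun _ _ _ => rfl) y
    show V τ y = UnboundedOperators.heatExtension (W s) (τ - s) y - oseenDuhamel 1 s V V τ y
    rw [hD, sub_zero, hWs, UnboundedOperators.heatExtension_const _ (sub_pos.2 hτ.1)]
  have key := oseenMild_bounded_unique one_pos hM hum hvm huM hvM hu hv t htI
  have heq := (Continuous.ae_eq_iff_eq volume (hW.continuous_slice ht) continuous_const).1 key
  exact congr_fun heq x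

/-- **A singular element of the class has no irrotational slice**: if `W ∈ A_C` is singular at
the space–time origin then `curl W(s, ·) ≢ 0` for every `s < 0`. An irrotational bounded
divergence-free slice is constant (KNSS 2009 Lemma 3.1), the field is then constant on
`(s, 0) × ℝ³` (`eq_const_after_of_slice_const`), hence bounded near the origin. [cite: KochNadirashviliSereginSverak2009, Lemma 3.1 (arXiv:0709.3599)] -/
theorem exists_curl_ne_zero_of_singular {C : ℝ}
    {W : ℝ → EuclideanSpace ℝ (Fin 3) → EuclideanSpace ℝ (Fin 3)} (hW : IsTypeIAncientMild C W)
    (hsing : ∀ r > 0, ∀ M : ℝ, ∃ t ∈ Set.Ioo (-(r ^ 2)) (0 : ℝ),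
      ∃ x ∈ Metric.ball (0 : EuclideanSpace ℝ (Fin 3)) r, M < ‖W t x‖)
    {s : ℝ} (hs : s < 0) : ∃ x, curl (W s) x ≠ 0 := by
  by_contra h
  push Not at h
  -- the slice is constant
  have hb : ∀ x, W s x = W s 0 := fun x =>
    eq_of_curl_eq_zero_of_isDivFree_of_bounded ((hW.contDiff_slice hs).of_le (by norm_cast)) h
      (hW.isDivFree hs) (fun z => hW.norm_le hs z) x 0
  set b := W s 0
  -- hence the field is constant on `(s, 0)`, and bounded by `‖b‖` near the origin
  set r : ℝ := min 1 (Real.sqrt (-s)) with hr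
  have hr0 : 0 < r := lt_min one_pos (Real.sqrt_pos.2 (by linarith))
  have hr2 : r ^ 2 ≤ -s := by
    have h1 : r ≤ Real.sqrt (-s) := min_le_right _ _
    calc r ^ 2 ≤ Real.sqrt (-s) ^ 2 := by gcongr
      _ = -s := Real.sq_sqrt (by linarith)
  obtain ⟨t, ht, x, -, hM⟩ := hsing r hr0 ‖b‖
  have hst : s < t := by linarith [ht.1]
  rw [eq_const_after_of_slice_const hW hb hst ht.2 x] at hM
  exact lt_irrefl _ hM

/-- **Uniform vorticity floor at `t = −1`.** For every `C` there is `η > 0` such that every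
element of `𝒦_C` singular at the space–time origin has a point `x` with `‖ω(−1, x)‖ ≥ η`.
Otherwise singular `u_n ∈ 𝒦_C` with `sup_x ‖ω_{u_n}(−1,x)‖ < 1/(n+1)` subconverge with their
gradients (`exists_tendsto_of_typeI_seq_Ioo`) to a singular element (`clockLaw_singular_of_limit`)
with an irrotational slice at `−1`, against `exists_curl_ne_zero_of_singular`. [cite: AlbrittonBarker2019, Lemma 2.2 and Prop. 2.3 (arXiv:1811.00502)] -/
theorem uniformVorticityFloor_at_neg_one (C : ℝ) :
    ∃ η > 0, ∀ u : ℝ → EuclideanSpace ℝ (Fin 3) → EuclideanSpace ℝ (Fin 3), IsTypeIAncientMild C u →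
      (∀ (x₀ : EuclideanSpace ℝ (Fin 3)) (t₀ r : ℝ), t₀ ≤ 0 → 0 < r →
        (∀ t, t₀ - r ^ 2 < t → t < t₀ → r⁻¹ * ∫ x in Metric.ball x₀ r, ‖u t x‖ ^ 2 ≤ C) ∧
          r⁻¹ * ∫ t in Set.Ioo (t₀ - r ^ 2) t₀, ∫ x in Metric.ball x₀ r, ‖fderiv ℝ (u t) x‖ ^ 2 ≤ C) →
      (∀ r > 0, ∀ M : ℝ, ∃ t ∈ Set.Ioo (-(r ^ 2)) (0 : ℝ),
        ∃ x ∈ Metric.ball (0 : EuclideanSpace ℝ (Fin 3)) r, M < ‖u t x‖) →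
      ∃ x, η ≤ ‖curl (u (-1)) x‖ := by
  by_contra h
  push Not at h
  -- a sequence of singular elements whose vorticity at `-1` is `< 1/(n+1)` everywhere
  have hseq : ∀ n : ℕ, ∃ u : ℝ → EuclideanSpace ℝ (Fin 3) → EuclideanSpace ℝ (Fin 3),
      IsTypeIAncientMild C u ∧
      (∀ (x₀ : EuclideanSpace ℝ (Fin 3)) (t₀ r : ℝ), t₀ ≤ 0 → 0 < r →
        (∀ t, t₀ - r ^ 2 < t → t < t₀ → r⁻¹ * ∫ x in Metric.ball x₀ r, ‖u t x‖ ^ 2 ≤ C) ∧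
          r⁻¹ * ∫ t in Set.Ioo (t₀ - r ^ 2) t₀, ∫ x in Metric.ball x₀ r, ‖fderiv ℝ (u t) x‖ ^ 2 ≤ C) ∧
      (∀ r > 0, ∀ M : ℝ, ∃ t ∈ Set.Ioo (-(r ^ 2)) (0 : ℝ),
        ∃ x ∈ Metric.ball (0 : EuclideanSpace ℝ (Fin 3)) r, M < ‖u t x‖) ∧
      ∀ x, ‖curl (u (-1)) x‖ < 1 / ((n : ℝ) + 1) := fun n => by
    obtain ⟨u, hu, hE, hsing, hlt⟩ := h _ Nat.one_div_pos_of_nat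
    exact ⟨u, hu, hE, hsing, hlt⟩
  choose u hu hE hsing hlt using hseq
  -- compactness on the growing windows `(-(k+1), 0)`
  set A : ℕ → ℝ := fun k => -((k : ℝ) + 1) with hA
  have hAt : Tendsto A atTop atBot :=
    tendsto_neg_atTop_atBot.comp (tendsto_natCast_atTop_atTop.atTop_add tendsto_const_nhds)
  have hcont : ∀ k, ContinuousOn (uncurry (u k)) (Ioo (A k) 0 ×ˢ univ) := fun k =>
    (hu k).continuousOn_uncurry.mono (prod_mono (fun t ht => ht.2) subset_rfl)
  have hdivw : ∀ k, ∀ t ∈ Ioo (A k) 0, IsWeaklyDivFree (u k t) := fun k t ht =>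
    (hu k).isWeaklyDivFree ht.2
  have hmild : ∀ k, ∀ s t : ℝ, A k < s → s < t → t < 0 → ∀ x,
      u k t x = UnboundedOperators.heatExtension (u k s) (t - s) x -
        oseenDuhamel 1 s (u k) (u k) t x :=
    fun k s t _ hst ht x => (hu k).mild_eq_heatExtension hst ht x
  have hI : ∀ k, ∀ t ∈ Ioo (A k) 0, ∀ x, ‖u k t x‖ ≤ C / Real.sqrt (-t) := fun k t ht x =>
    (hu k).norm_le ht.2 x
  obtain ⟨φ, hφ, W, hW, hpt, hptG, -, -⟩ :=
    exists_tendsto_of_typeI_seq_Ioo C hAt hcont hdivw hmild hI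
  -- the limit is singular
  have hWsing := clockLaw_singular_of_limit (fun j => hu (φ j)) (fun j => hE (φ j))
    (fun j => hsing (φ j)) hpt
  -- its vorticity at `-1` is the limit of the vorticities, hence zero
  have hcurlW : ∀ x, curl (W (-1)) x = 0 := by
    intro x
    have hconv : Tendsto (fun j => curl (u (φ j) (-1)) x) atTop (𝓝 (curl (W (-1)) x)) := by
      simp only [curl_eq_curlCLM]
      exact (curlCLM.continuous.tendsto _).comp (hptG (-1) (by norm_num) x)
    have hb : Tendsto (fun j : ℕ => 1 / ((φ j : ℝ) + 1)) atTop (𝓝 0) :=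
      (tendsto_one_div_add_atTop_nhds_zero_nat (𝕜 := ℝ)).comp hφ.tendsto_atTop
    have hle : ‖curl (W (-1)) x‖ ≤ 0 :=
      le_of_tendsto_of_tendsto' hconv.norm hb fun j => (hlt (φ j) x).le
    exact norm_le_zero_iff.1 hle
  -- contradiction with the absence of irrotational slices of singular elements
  obtain ⟨x, hx⟩ := exists_curl_ne_zero_of_singular hW hWsing (by norm_num : (-1 : ℝ) < 0)
  exact hx (hcurlW x)

/-- **The class-uniform, all-time gauge vorticity floor of singular Type-I models** (portrait
clause of crux `ClockCeiling` / the Type-I Liouville node). For every `C` there is `η > 0` such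
that every element `u ∈ 𝒦_C` (Type-I KNSS-mild with the scale-invariant energy ledger) that is
singular at the space–time origin has, at EVERY `t < 0`, a point `x` with `(−t)‖ω(t, x)‖ ≥ η`.
The floor at `t = −1` (`uniformVorticityFloor_at_neg_one`) transported by the Navier–Stokes zoom
`u_c = c u(c² ·, c ·)`, `c = √(−t)`, which stays in the singular part of `𝒦_C`
(`isTypeIAncientMild_zoom`, `limitSingular_energyLedger_zoom`, `clockLaw_singular_zoom`) and has
`curl u_c(−1, y) = (−t) ω(t, c y)` (`curl_smul_stPull`). [cite: KochNadirashviliSereginSverak2009, §1 (1.2) and Lemma 3.1 (arXiv:0709.3599)] -/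
theorem uniformVorticityFloor (C : ℝ) :
    ∃ η > 0, ∀ u : ℝ → EuclideanSpace ℝ (Fin 3) → EuclideanSpace ℝ (Fin 3), IsTypeIAncientMild C u →
      (∀ (x₀ : EuclideanSpace ℝ (Fin 3)) (t₀ r : ℝ), t₀ ≤ 0 → 0 < r →
        (∀ t, t₀ - r ^ 2 < t → t < t₀ → r⁻¹ * ∫ x in Metric.ball x₀ r, ‖u t x‖ ^ 2 ≤ C) ∧
          r⁻¹ * ∫ t in Set.Ioo (t₀ - r ^ 2) t₀, ∫ x in Metric.ball x₀ r, ‖fderiv ℝ (u t) x‖ ^ 2 ≤ C) →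
      (∀ r > 0, ∀ M : ℝ, ∃ t ∈ Set.Ioo (-(r ^ 2)) (0 : ℝ),
        ∃ x ∈ Metric.ball (0 : EuclideanSpace ℝ (Fin 3)) r, M < ‖u t x‖) →
      ∀ t < 0, ∃ x, η ≤ (-t) * ‖curl (u t) x‖ := by
  obtain ⟨η, hη, hfloor⟩ := uniformVorticityFloor_at_neg_one C
  refine ⟨η, hη, fun u hu hE hsing t ht => ?_⟩
  set c : ℝ := Real.sqrt (-t) with hcdef
  have hc : 0 < c := Real.sqrt_pos.2 (neg_pos.2 ht)
  have hc2 : c ^ 2 = -t := Real.sq_sqrt (neg_pos.2 ht).le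
  -- the zoom is a singular element of the class
  have hv : IsTypeIAncientMild C (c • stPull (c ^ 2) c 0 0 u) := isTypeIAncientMild_zoom hu hc 0
  have hvE := limitSingular_energyLedger_zoom hu hE hc
  have hvsing := clockLaw_singular_zoom hsing hc
  obtain ⟨y, hy⟩ := hfloor _ hv hvE hvsing
  refine ⟨c • y, ?_⟩
  rw [curl_smul_stPull, zero_add, zero_add, norm_smul, Real.norm_of_nonneg (mul_pos hc hc).le,
    ← sq, hc2, show -t * (-1 : ℝ) = t by ring] at hy
  exact hy

/-- **Stub `stub_uniformVorticityFloor` (crux stmt-NavierStokesRegularity-10570, line `registered`,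
portrait clause), in the vocabulary of the route's class `𝒦_C`** (the hypotheses of
`ClockCeiling` verbatim): for every `C` there is `η > 0` such that every SINGULAR element of
`𝒦_C` has `sup_x (−t)‖curl u(t, x)‖ ≥ η` at every `t < 0`. [cite: KochNadirashviliSereginSverak2009, Lemma 3.1 and Remark 6.1 (arXiv:0709.3599)] -/
theorem stub_uniformVorticityFloor :
    ∀ C : ℝ, ∃ η > 0, ∀ u : ℝ → EuclideanSpace ℝ (Fin 3) → EuclideanSpace ℝ (Fin 3), (ContDiffOn ℝ (⊤ : ℕ∞) (Function.uncurry u) (Set.Iio 0 ×ˢ Set.univ) ∧ (∀ t < 0, Literature.Analysis.FluidPDE.VectorCalculus.IsDivFree (u t)) ∧ (∀ s t : ℝ, s < t → t < 0 → ∀ x, u t x = Literature.Analysis.FluidPDE.heatFlow (u s) (t - s) x - ∫ τ in Set.Ioo s t, ∫ y, ((-(inner ℝ (x - y) (u τ y) / (2 * (t - τ)) * Literature.Analysis.UnboundedOperators.heatKernel (t - τ) (x - y))) • u τ y + (∫ σ in Set.Ioi (t - τ), Literature.Analysis.UnboundedOperators.heatKernel σ (x - y) / (4 * σ ^ 2))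 • (inner ℝ (x - y) (u τ y) • u τ y + inner ℝ (u τ y) (u τ y) • (x - y) + inner ℝ (x - y) (u τ y) • u τ y) - ((∫ σ in Set.Ioi (t - τ), Literature.Analysis.UnboundedOperators.heatKernel σ (x - y) / (8 * σ ^ 3)) * (inner ℝ (x - y) (u τ y) * inner ℝ (x - y) (u τ y))) • (x - y))) ∧ Literature.Analysis.FluidPDE.HasTypeITimeDecay C u ∧ (∀ (x₀ : EuclideanSpace ℝ (Fin 3)) (t₀ r : ℝ), t₀ ≤ 0 → 0 < r → (∀ t, t₀ - r ^ 2 < t → t < t₀ → r⁻¹ * ∫ x in Metric.ball x₀ r, ‖u t x‖ ^ 2 ≤ C) ∧ r⁻¹ * ∫ t in Set.Ioo (t₀ - r ^ 2) t₀, ∫ x in Metric.ball x₀ r, ‖fderiv ℝ (u t) x‖ ^ 2 ≤ C)) →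
      (∀ r > 0, ∀ M : ℝ, ∃ t ∈ Set.Ioo (-(r ^ 2)) (0 : ℝ), ∃ x ∈ Metric.ball (0 : EuclideanSpace ℝ (Fin 3)) r, M < ‖u t x‖) →
      ∀ t < 0, ∃ x : EuclideanSpace ℝ (Fin 3), η ≤ (-t) * ‖Literature.Analysis.FluidPDE.curl (u t) x‖ := by
  intro C
  obtain ⟨η, hη, hfloor⟩ := uniformVorticityFloor C
  refine ⟨η, hη, fun u hu hsing t ht => ?_⟩
  have hTI : IsTypeIAncientMild C u :=
    isTypeIAncientMild_iff.2 ⟨hu.1, hu.2.1, hu.2.2.1, hu.2.2.2.1⟩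
  exact hfloor u hTI hu.2.2.2.2 hsing t ht

end Summit.NavierStokesRegularity.NavierStokesRegularity.Theorems

end
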